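import Literature.AlgebraicGeometry.HodgeTheory.HomComplex
import Literature.AlgebraicGeometry.Modules.TensorSheafHomAdjunction
import Literature.AlgebraicGeometry.Modules.InvertibleModule
import Literature.AlgebraicGeometry.Modules.TensorUnitors
import Literature.AlgebraicGeometry.Modules.SheafHomExact
import Literature.AlgebraicGeometry.Modules.ModulesGrothendieckAbelian
import Literature.Algebra.Homology.KInjectiveAdjunction
import Mathlib.Algebra.Homology.Factorizations.CM5a
import HarnessLib

/-!
# The derived tensor–hom adjunction for a vector bundle:
# `Hom_D(Q(E₀ ⊗ M•), (Q F•)⟦k⟧) ≃ Hom_D(Q M•, (Q 𝓗om(E₀, F•))⟦k⟧)`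

Hartshorne III Prop. 6.7: for `𝓛` locally free of finite rank and any `𝓕`, `𝓖`,
`Extⁱ(𝓕 ⊗ 𝓛, 𝓖) ≅ Extⁱ(𝓕, 𝓛^∨ ⊗ 𝓖)` (`= Extⁱ(𝓕, 𝓗om(𝓛, 𝓖))` by II Ex. 5.1 (b)); the proof there is the
case `i = 0` (II Ex. 5.1 (c), the tensor–hom adjunction) plus effaceability. This file proves the
DERIVED-CATEGORY form for COMPLEXES, by the K-injective road already used in the tree for `g^* ⊣ g_*`
(`Modules/PullbackPushforwardDerivedAdjunction.lean`):

* §1 `shiftedHomLinearEquivTensorSheafHomOfInjective` — for `E₀` finite locally free, `M•` any cochain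
  complex and `I•` a bounded-below complex of injective `𝒪_X`-modules,
  `Hom_{D(X)}(Q((E₀ ⊗ –)• M•), (Q I•)⟦k⟧) ≃ₗ[𝕜] Hom_{D(X)}(Q M•, (Q (𝓗om(E₀, –)• I•))⟦k⟧)`
  (`Literature.Algebra.Homology.KInjectiveAdjunction.shiftedHomLinearEquivOfAdjunction` applied to the
  module-level adjunction `E₀ ⊗ – ⊣ 𝓗om(E₀, –)` of `Modules/TensorSheafHomAdjunction.lean`; its
  hypothesis «the left adjoint preserves monomorphisms» is flatness of the vector bundle `E₀`,
  `preservesMonomorphisms_tensorBifunctor_obj`);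
* §2 `shiftedHomLinearEquivTensorSheafHom` — the same for ANY bounded-below target `F•`: choose an
  injective resolution `ι : F• ⟶ I•` (Mathlib `CochainComplex.Plus.modelCategoryQuillen.exists_quasiIso_injective`,
  enough injectives in `Mod(𝒪_X)` from `Modules/ModulesGrothendieckAbelian.lean`); `𝓗om(E₀, ι)` is again a
  quasi-isomorphism because `𝓗om(E₀, –)` is exact for `E₀` finite locally free
  (`Modules/SheafHomExact.preservesHomology_sheafHomFunctor`);
* §3 the case `M• = 𝒪_X[0]` — **the derived unit adjunction for a vector bundle**:
  `singleTensorUnitIso : (E₀ ⊗ –)•(𝒪_X[0]) ≅ E₀[0]` and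
  `shiftedHomLinearEquivSingleHomComplex : Hom_D(Q E₀[0], (Q F•)⟦k⟧) ≃ₗ[𝕜]
  Hom_D(Q 𝒪_X[0], (Q 𝓗om•(E₀[0], F•))⟦k⟧)` (through the column isomorphism
  `𝓗om•(E₀[0], F•) ≅ 𝓗om(E₀, F•)` of `HodgeTheory/HomComplex.lean`), i.e.
  `Extᵏ(E₀, F•) ≅ ℍᵏ(X, 𝓗om(E₀, F•)) = ℍᵏ(X, E₀^∨ ⊗ F•)` — Hartshorne III 6.7 with `𝓕 = 𝒪_X` combined
  with III 6.3 (c), for complexes.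

Everything is a construction with a body or a proved statement; no named facts, no instances, no
`sorry` (the additivity of `E₀ ⊗ –`, `Modules/InvertibleModule.additive_tensorBifunctor_obj`, is a theorem
in the tree, not an instance, so §§1–2 take it as an instance binder and §3 supplies it by `haveI`). Use (Hodge programme, road №4, crux 26512, shelf item (β3) «derived duality for bounded
vector-bundle complexes», road K, brick (A) in the one-term case): library only — proves nothing about
26512, №4, HC_AV or HC. NOT here: the first variable a bounded COMPLEX `E•` of vector bundles (needs the
chain-level identification `Hom_K(E•, I•⟦k⟧) ≃ Hom_K(𝒪_X[0], 𝓗om•(E•, I•)⟦k⟧)`), naturality in `E₀`.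

## References

* R. Hartshorne, *Algebraic Geometry*, GTM 52 (1977), III Prop. 6.7 p. 235 (`Extⁱ(𝓕 ⊗ 𝓛, 𝓖) ≅
  Extⁱ(𝓕, 𝓛^∨ ⊗ 𝓖)`), III Prop. 6.3 (c) p. 234, II Ex. 5.1 (b)–(c) p. 123. [Hartshorne1977]
* N. Spaltenstein, *Resolutions of unbounded complexes*, Compositio Math. 65 (1988), §1 (K-injective
  complexes compute `Hom` in `D`). [Spaltenstein1988]
* The Stacks Project, Tag 08BY (the derived tensor–hom adjunction `RHom(K ⊗ᴸ L, M) = RHom(K, RHom(L, M))`),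
  Tag 0A8H (cohomology and internal hom). [StacksProject]
-/

noncomputable section

open CategoryTheory CategoryTheory.Limits AlgebraicGeometry Opposite

universe w u

namespace Literature.AlgebraicGeometry.HodgeTheory

open Literature.AlgebraicGeometry.Modules Literature.AlgebraicGeometry.Motives Literature.Algebra.Homology

variable {X : Scheme.{u}} {𝕜 : Type*} [Ring 𝕜] [Linear 𝕜 X.Modules] [HasDerivedCategory.{w} X.Modules]

/-! ## §1 Injective target -/

/-- **Derived tensor–hom adjunction, injective target**: `E₀` finite locally free, `M•` any complex,
`I•` a bounded-below complex of injective `𝒪_X`-modules, `k : ℤ`: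
`Hom_{D(X)}(Q((E₀ ⊗ –)• M•), (Q I•)⟦k⟧) ≃ₗ[𝕜] Hom_{D(X)}(Q M•, (Q (𝓗om(E₀, –)• I•))⟦k⟧)` — both targets are
K-injective (`𝓗om(E₀, –)` preserves injectives because its left adjoint `E₀ ⊗ –` preserves
monomorphisms) and the termwise adjunction identifies homotopy classes.
[cite: Hartshorne1977, III Prop. 6.7 (p. 235) and II Ex. 5.1 (c) (p. 123)] [cite: Spaltenstein1988, §1] -/
def shiftedHomLinearEquivTensorSheafHomOfInjective (E₀ : X.Modules) (hE₀ : IsFiniteLocallyFree E₀)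
    [((tensorBifunctor X).obj E₀).Additive] [(sheafHomFunctor E₀).Linear 𝕜]
    (M I : CochainComplex X.Modules ℤ) (a : ℤ) [I.IsStrictlyGE a] [∀ n, Injective (I.X n)] (k : ℤ) :
    ShiftedHom (DerivedCategory.Q.obj ((((tensorBifunctor X).obj E₀).mapHomologicalComplex
        (ComplexShape.up ℤ)).obj M)) (DerivedCategory.Q.obj I) k ≃ₗ[𝕜]
      ShiftedHom (DerivedCategory.Q.obj M) (DerivedCategory.Q.obj
        (((sheafHomFunctor E₀).mapHomologicalComplex (ComplexShape.up ℤ)).obj I)) k :=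
  haveI : ((tensorBifunctor X).obj E₀).PreservesMonomorphisms :=
    preservesMonomorphisms_tensorBifunctor_obj hE₀
  shiftedHomLinearEquivOfAdjunction (tensorSheafHomAdj E₀) M I a k

/-! ## §2 Bounded-below target -/

omit [Linear 𝕜 X.Modules] [HasDerivedCategory.{w} X.Modules] in
/-- `𝓗om(E₀, –)` termwise takes quasi-isomorphisms to quasi-isomorphisms when `E₀` is finite locally
free (it is exact). [cite: Hartshorne1977, III Prop. 6.7 (p. 235), proof («tensoring with 𝓛 is an exact functor»)] -/
theorem quasiIso_sheafHomFunctor_map (E₀ : X.Modules) (hE₀ : IsFiniteLocallyFree E₀)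
    {F F' : CochainComplex X.Modules ℤ} (φ : F ⟶ F') [QuasiIso φ] :
    QuasiIso (((sheafHomFunctor E₀).mapHomologicalComplex (ComplexShape.up ℤ)).map φ) :=
  haveI := preservesHomology_sheafHomFunctor E₀ hE₀
  inferInstance

/-- **Derived tensor–hom adjunction for a vector bundle** (Hartshorne III 6.7 for complexes): `E₀` finite
locally free, `M•` any complex, `F•` bounded below, `k : ℤ`:
`Hom_{D(X)}(Q((E₀ ⊗ –)• M•), (Q F•)⟦k⟧) ≃ₗ[𝕜] Hom_{D(X)}(Q M•, (Q (𝓗om(E₀, –)• F•))⟦k⟧)` — transport of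
§1 along an injective resolution `F• ⟶ I•` and the quasi-isomorphism `𝓗om(E₀, F•) ⟶ 𝓗om(E₀, I•)`.
[cite: Hartshorne1977, III Prop. 6.7 (p. 235)] [cite: StacksProject, Tag 08BY] -/
def shiftedHomLinearEquivTensorSheafHom (E₀ : X.Modules) (hE₀ : IsFiniteLocallyFree E₀)
    [((tensorBifunctor X).obj E₀).Additive] [(sheafHomFunctor E₀).Linear 𝕜]
    (M F : CochainComplex X.Modules ℤ) (a : ℤ) [F.IsStrictlyGE a] (k : ℤ) :
    ShiftedHom (DerivedCategory.Q.obj ((((tensorBifunctor X).obj E₀).mapHomologicalComplex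
        (ComplexShape.up ℤ)).obj M)) (DerivedCategory.Q.obj F) k ≃ₗ[𝕜]
      ShiftedHom (DerivedCategory.Q.obj M) (DerivedCategory.Q.obj
        (((sheafHomFunctor E₀).mapHomologicalComplex (ComplexShape.up ℤ)).obj F)) k := by
  let hres := CochainComplex.Plus.modelCategoryQuillen.exists_quasiIso_injective F a
  let I := hres.choose
  let ι : F ⟶ I := hres.choose_spec.choose
  haveI hι : QuasiIso ι := hres.choose_spec.choose_spec.choose
  haveI hI : ∀ n, Injective (I.X n) := hres.choose_spec.choose_spec.choose_spec.choose
  haveI hIa : I.IsStrictlyGE a := hres.choose_spec.choose_spec.choose_spec.choose_spec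
  haveI : ((tensorBifunctor X).obj E₀).PreservesMonomorphisms :=
    preservesMonomorphisms_tensorBifunctor_obj hE₀
  exact shiftedHomLinearEquivOfAdjunctionOfQuasiIso (tensorSheafHomAdj E₀) M ι a
    (quasiIso_sheafHomFunctor_map E₀ hE₀ ι) k

/-! ## §3 The derived unit adjunction for a vector bundle (`M• = 𝒪_X[0]`) -/

/-- `(E₀ ⊗ –)•(𝒪_X[0]) ≅ E₀[0]` (single complexes commute with additive functors; right unitor).
[cite: Hartshorne1977, II Ex. 5.1 (p. 123)] -/
def singleTensorUnitIso (E₀ : X.Modules) [((tensorBifunctor X).obj E₀).Additive] :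
    (((tensorBifunctor X).obj E₀).mapHomologicalComplex (ComplexShape.up ℤ)).obj
        ((HomologicalComplex.single X.Modules (ComplexShape.up ℤ) 0).obj (unitModule X)) ≅
      (HomologicalComplex.single X.Modules (ComplexShape.up ℤ) 0).obj E₀ :=
  (HomologicalComplex.singleMapHomologicalComplex ((tensorBifunctor X).obj E₀) (ComplexShape.up ℤ) 0).app
      (unitModule X) ≪≫
    (HomologicalComplex.single X.Modules (ComplexShape.up ℤ) 0).mapIso (tensorUnitRightIso E₀)

/-- **The derived unit adjunction for a vector bundle**: `E₀` finite locally free, `F•` bounded below: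
`Hom_{D(X)}(Q E₀[0], (Q F•)⟦k⟧) ≃ₗ[𝕜] Hom_{D(X)}(Q 𝒪_X[0], (Q 𝓗om•(E₀[0], F•))⟦k⟧)`, i.e.
`Extᵏ(E₀, F•) ≅ ℍᵏ(X, 𝓗om(E₀, F•))` — §2 at `M• = 𝒪_X[0]`, `singleTensorUnitIso`, and the column
isomorphism `𝓗om•(E₀[0], F•) ≅ 𝓗om(E₀, F•)` (`HomComplex.columnIso`).
[cite: Hartshorne1977, III Prop. 6.7 (p. 235) and III Prop. 6.3 (c) (p. 234)] [cite: StacksProject, Tag 08BY] -/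
def shiftedHomLinearEquivSingleHomComplex (E₀ : X.Modules) (hE₀ : IsFiniteLocallyFree E₀)
    [(sheafHomFunctor E₀).Linear 𝕜] (F : CochainComplex X.Modules ℤ) (a : ℤ) [F.IsStrictlyGE a] (k : ℤ) :
    ShiftedHom (DerivedCategory.Q.obj ((HomologicalComplex.single X.Modules (ComplexShape.up ℤ) 0).obj E₀))
        (DerivedCategory.Q.obj F) k ≃ₗ[𝕜]
      ShiftedHom (DerivedCategory.Q.obj
          ((HomologicalComplex.single X.Modules (ComplexShape.up ℤ) 0).obj (unitModule X)))
        (DerivedCategory.Q.obj (homComplex X (HomComplex.single₀ X E₀) F)) k :=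
  haveI : ((tensorBifunctor X).obj E₀).Additive := additive_tensorBifunctor_obj E₀
  (Linear.homCongr 𝕜 (DerivedCategory.Q.mapIso (singleTensorUnitIso E₀)).symm (Iso.refl _)).trans <|
    (shiftedHomLinearEquivTensorSheafHom E₀ hE₀ _ F a k).trans
      (Linear.homCongr 𝕜 (Iso.refl _) ((shiftFunctor (DerivedCategory X.Modules) k).mapIso
        (DerivedCategory.Q.mapIso (HomComplex.columnIso X E₀ F).symm)))

end Literature.AlgebraicGeometry.HodgeTheory

end
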